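import Mathlib
import Literature.NumberTheory.LFunctions.Zhang2022.Section4Prop22iiiRouche
import HarnessLib

/-!
# Zhang (2022), §4: Lemma 4.7 and Prop. 2.2 (iii) from (4.12) on `Re w > −α` ONLY — the
# three-small-circle route with the reflection `w ↦ −w̄` (GAP row G-L1t7-1 made immaterial)

Topic `Literature/NumberTheory/LFunctions/Zhang2022` (Landau–Siegel audit tree; verdict-neutral).
Y. Zhang, *Discrete mean estimates and the Landau–Siegel zero*, arXiv:2211.02515v1 (2022)
[Zhang2022LandauSiegel] — **an unrefereed manuscript under adjudication**; CLAIM nodes stated not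
asserted. The campaign's GAP row G-L1t7-1 records that (4.10) is STATED on
`Ω₃ = {½ − α < σ < 1 + α, …}` but USED, in the proofs of (4.12) and Lemma 4.7, down to `σ = ½ − 2α`;
accordingly the tree derives (4.12) from Lemmas 4.2–4.3, (4.6) and (4.10) only on the half-disc
`|w| < 2α, Re w > −α` (`Section4.eq412_inner_of`, slice sz-d07). This file shows that the half-disc
form SUFFICES for Lemma 4.7 and Prop. 2.2 (iii) (DAG `Z22:Lem4.7`, `Z22:Lem4.7.pf`,
`Z22:Prop2.2` (iii)): the Rouché circles `|w − ikα| = α(1−c′α𝓛)`, `k ∈ {−1,0,1}`, of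
`Section4Lemma47Rouche` lie in `|Re w| < α`, and the lattice placement of an arbitrary zero `w`
(`|w| < 2α`) of `𝒜(ρ+·,ψ)` is obtained at `w` or at its reflection `−w̄` — for `ρ` on the critical
line the zeros of `𝒜 = L·L/F` are symmetric under `w ↦ −w̄` (`L(s,ψ)L(s,ψχ)` vanishes at `1 − s̄`
with `s`, `TypedSection04C.llZeroReflect_holds`; `F ≠ 0` near the line by Lemma 4.2):

* `zero_near_lattice_of_inner`, `small_disc_unique_zero_inner`, `three_zeros_of_rouche_inner` —
  the located zeros `{0, iα+v₁, −iα+v₋₁}`, `|v_{±1}| < c′α²𝓛`, from Lemma 4.2 and half-disc (4.12);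
  the hypothesis `(4.12)ₕₐₗf` being VERBATIM the conclusion of `Section4.eq412_inner_of : Lemma42 →
  Lemma43 → Eq46 → Eq410 → …`; the nodes `Lemma47 c′` / `Prop22iii c′` follow in the companion
  `Section4RoucheInnerEdges` (`lemma47_of_rouche_inner`, `prop22iii_of_rouche_inner`).

What is NOT asserted: Rouché (binder); Lemma 4.2; the half-disc (4.12); Prop. 2.2 (i). Nothing about
Theorems 1–2 of the source is stated or implied; nothing here bears on the verdict on (8.24).

## References

* Y. Zhang, arXiv:2211.02515v1 (2022), §4 pp. 21–23 ((4.10), (4.12), Lemma 4.7), §2 p. 5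
  (Prop. 2.2 (iii)). [cite: Zhang2022LandauSiegel, §4 Lemma 4.7; §2 Prop. 2.2 (iii)]
-/

noncomputable section

open Complex Real Set Filter Topology

namespace Literature.NumberTheory.LFunctions.Zhang2022.Section4

open Literature.NumberTheory.LFunctions.Zhang2022.Skeleton

variable {D : ℕ}

section Pieces

variable [NeZero D] (χ : DirichletCharacter ℂ D) (x : Chr D) (ρ : ℂ)

/-- **Zeros lie near the lattice `iαℤ` — from (4.12) on `Re w > −α` and the reflection
`w ↦ −w̄`**: if `|𝒜(ρ+w) − (1−P^{−2w})| ≤ η` for `|w| < 2α`, `Re w > −α` (`η ≤ 1/8`) and the zeros of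
`𝒜(ρ+·)` in `|w| < 2α` are symmetric under `w ↦ −w̄`, every zero `w` there satisfies
`|w − ikα| ≤ 2ηα` for some `k ∈ ℤ` (apply the lattice lemma at `w` or at `−w̄`; `ikα` is fixed by
`w ↦ −w̄`). [cite: Zhang2022LandauSiegel, §4 Lemma 4.7 (proof)] -/
theorem zero_near_lattice_of_inner {η : ℝ} (hℓ0 : 0 < ell D) (hα : 0 < alpha D) (hη : η ≤ 1 / 8)
    (E412 : ∀ w : ℂ, ‖w‖ < 2 * alpha D → -alpha D < w.re →
      ‖calA χ x (ρ + w) - (1 - Pm2w D w)‖ ≤ η)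
    (hsymm : ∀ w : ℂ, ‖w‖ < 2 * alpha D → calA χ x (ρ + w) = 0 →
      calA χ x (ρ + -(starRingEnd ℂ w)) = 0)
    {w : ℂ} (hw : ‖w‖ < 2 * alpha D) (hzero : calA χ x (ρ + w) = 0) :
    ∃ k : ℤ, ‖w - (k : ℂ) * I * (alpha D : ℂ)‖ ≤ 2 * η * alpha D := by
  -- the direct case `Re w > −α`
  have direct : ∀ w : ℂ, ‖w‖ < 2 * alpha D → -alpha D < w.re → calA χ x (ρ + w) = 0 →
      ∃ k : ℤ, ‖w - (k : ℂ) * I * (alpha D : ℂ)‖ ≤ 2 * η * alpha D := by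
    intro w hw hwre hz
    have h := E412 w hw hwre
    rw [hz, zero_sub, norm_neg, Pm2w_eq_exp_div hℓ0] at h
    obtain ⟨k, hk⟩ := exists_int_near_of_norm_one_sub_exp_le (by linarith) h
    refine ⟨k, ?_⟩
    have hα0 : (alpha D : ℂ) ≠ 0 := Complex.ofReal_ne_zero.mpr hα.ne'
    have heq : w - (k : ℂ) * I * (alpha D : ℂ) =
        (w / (alpha D : ℂ) - (k : ℂ) * I) * (alpha D : ℂ) := by
      field_simp
    rw [heq, norm_mul, Complex.norm_real, Real.norm_of_nonneg hα.le]
    exact mul_le_mul_of_nonneg_right hk hα.le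
  by_cases hre : -alpha D < w.re
  · exact direct w hw hre hzero
  · -- reflect: `−w̄` is a zero with `Re(−w̄) = −Re w ≥ α > −α`
    push Not at hre
    have hw' : ‖-(starRingEnd ℂ w)‖ < 2 * alpha D := by rwa [norm_neg, Complex.norm_conj]
    have hre' : -alpha D < (-(starRingEnd ℂ w)).re := by
      simp only [Complex.neg_re, Complex.conj_re]; linarith
    obtain ⟨k, hk⟩ := direct _ hw' hre' (hsymm w hw hzero)
    refine ⟨k, ?_⟩
    have heq : w - (k : ℂ) * I * (alpha D : ℂ) =
        -(starRingEnd ℂ (-(starRingEnd ℂ w) - (k : ℂ) * I * (alpha D : ℂ))) := by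
      simp only [map_sub, map_neg, map_mul, Complex.conj_conj, map_intCast, Complex.conj_I,
        Complex.conj_ofReal]
      ring
    rw [heq, norm_neg, Complex.norm_conj]
    exact hk

/-- **Rouché on the small circle `|w − ikα| = r`, `|k| ≤ 1`, from (4.12) on `Re w > −α`** ("in a
way similar to the proof of Lemma 4.6"): with `𝒜(ρ+·)` holomorphic on `|w| < 2α`,
`|𝒜(ρ+w) − (1−P^{−2w})| ≤ η` for `|w| < 2α`, `Re w > −α` (the small circles lie in `|Re w| ≤ r < α`),
`|1 − P^{−2z}| > η` on `|z| = r` ((4.13) and the period `iα`), and the zero set `{0}` of `1 − P^{−2w}`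
in `|w| < r`, the count form of Rouché (`hRouche`, FACT F-29 as a binder) gives exactly one zero of
`𝒜(ρ+·)` in `|w − ikα| < r`. [cite: Zhang2022LandauSiegel, §4 Lemma 4.7 (proof)] -/
theorem small_disc_unique_zero_inner
    (hRouche : ∀ (f g : ℂ → ℂ) (c : ℂ) (r : ℝ), 0 < r →
      (∃ U : Set ℂ, IsOpen U ∧ Metric.closedBall c r ⊆ U ∧ DifferentiableOn ℂ f U ∧
        DifferentiableOn ℂ g U) →
      (∀ z ∈ Metric.sphere c r, ‖f z - g z‖ < ‖g z‖) →
      ∑ᶠ z ∈ Metric.ball c r, analyticOrderNatAt f z =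
        ∑ᶠ z ∈ Metric.ball c r, analyticOrderNatAt g z)
    {r η : ℝ} (hℓ0 : 0 < ell D) (hD2 : 2 ≤ D) (hα : 0 < alpha D) (hr0 : 0 < r)
    (hrα : r < alpha D)
    (hA : DifferentiableOn ℂ (fun w : ℂ => calA χ x (ρ + w)) (Metric.ball 0 (2 * alpha D)))
    (E412 : ∀ w : ℂ, ‖w‖ < 2 * alpha D → -alpha D < w.re →
      ‖calA χ x (ρ + w) - (1 - Pm2w D w)‖ ≤ η)
    (hbig : ∀ z : ℂ, ‖z‖ = r → η < ‖1 - Pm2w D z‖)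
    (eone : {w : ℂ | ‖w‖ < r ∧ 1 - Pm2w D w = 0} = {0}) {k : ℤ} (hk : |k| ≤ 1) :
    ∃ v : ℂ, {v' : ℂ | ‖v'‖ < r ∧ calA χ x (ρ + ((k : ℂ) * I * (alpha D : ℂ) + v')) = 0} = {v} := by
  have hPer : ∀ w : ℂ, Pm2w D ((k : ℂ) * I * (alpha D : ℂ) + w) = Pm2w D w :=
    fun w => Pm2w_add_int_mul hℓ0 k w
  have hk' : |(k : ℝ)| ≤ 1 := by exact_mod_cast hk
  have hpk : ‖(k : ℂ) * I * (alpha D : ℂ)‖ ≤ alpha D := by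
    rw [norm_int_mul_I_mul_alpha hα.le]; nlinarith
  -- the shifted functions are holomorphic on `|v| < α`
  have hfk : DifferentiableOn ℂ
      (fun v : ℂ => calA χ x (ρ + ((k : ℂ) * I * (alpha D : ℂ) + v))) (Metric.ball 0 (alpha D)) := by
    have hmaps : Set.MapsTo (fun v : ℂ => (k : ℂ) * I * (alpha D : ℂ) + v)
        (Metric.ball 0 (alpha D)) (Metric.ball 0 (2 * alpha D)) := by
      intro v hv
      rw [mem_ball_zero_iff] at hv ⊢
      calc ‖(k : ℂ) * I * (alpha D : ℂ) + v‖ ≤ ‖(k : ℂ) * I * (alpha D : ℂ)‖ + ‖v‖ := norm_add_le _ _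
        _ < alpha D + alpha D := add_lt_add_of_le_of_lt hpk hv
        _ = 2 * alpha D := by ring
    exact hA.comp (((differentiable_const _).add differentiable_id).differentiableOn) hmaps
  have hgk_eq : (fun v : ℂ => 1 - Pm2w D ((k : ℂ) * I * (alpha D : ℂ) + v)) =
      fun v => 1 - Pm2w D v := funext fun v => by rw [hPer]
  have hgk : DifferentiableOn ℂ (fun v : ℂ => 1 - Pm2w D ((k : ℂ) * I * (alpha D : ℂ) + v))
      (Metric.ball 0 (alpha D)) := by
    rw [hgk_eq]; exact (differentiable_one_sub_Pm2w D).differentiableOn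
  -- Rouché on `|v| = r`
  have hcount := hRouche (fun v => calA χ x (ρ + ((k : ℂ) * I * (alpha D : ℂ) + v)))
    (fun v => 1 - Pm2w D ((k : ℂ) * I * (alpha D : ℂ) + v)) 0 r hr0
    ⟨Metric.ball 0 (alpha D), Metric.isOpen_ball, Metric.closedBall_subset_ball hrα, hfk, hgk⟩
    (fun z hz => by
      rw [mem_sphere_zero_iff_norm] at hz
      have hz2 : ‖(k : ℂ) * I * (alpha D : ℂ) + z‖ < 2 * alpha D := by
        calc ‖(k : ℂ) * I * (alpha D : ℂ) + z‖ ≤ ‖(k : ℂ) * I * (alpha D : ℂ)‖ + ‖z‖ :=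
              norm_add_le _ _
          _ < 2 * alpha D := by rw [hz]; linarith
      have hzre : -alpha D < ((k : ℂ) * I * (alpha D : ℂ) + z).re := by
        have hre : |z.re| ≤ ‖z‖ := Complex.abs_re_le_norm z
        have h0 : ((k : ℂ) * I * (alpha D : ℂ) + z).re = z.re := by simp
        rw [h0]
        have := (abs_le.mp hre).1
        linarith
      have h1 := E412 _ hz2 hzre
      have h2 := hbig z hz
      show ‖calA χ x (ρ + ((k : ℂ) * I * (alpha D : ℂ) + z)) -
          (1 - Pm2w D ((k : ℂ) * I * (alpha D : ℂ) + z))‖ <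
        ‖1 - Pm2w D ((k : ℂ) * I * (alpha D : ℂ) + z)‖
      rw [hPer] at h1 ⊢
      exact lt_of_le_of_lt h1 h2)
  -- the count of the comparison function is `1`
  rw [hgk_eq] at hcount
  have hg_an : AnalyticOnNhd ℂ (fun v : ℂ => 1 - Pm2w D v) (Metric.ball 0 r) :=
    (differentiable_one_sub_Pm2w D).differentiableOn.analyticOnNhd Metric.isOpen_ball
  rw [finsum_analyticOrderNatAt_eq_one_of_zeros_eq hg_an eone
    (deriv_one_sub_Pm2w_zero_ne_zero hD2)] at hcount
  have hf_an : AnalyticOnNhd ℂ (fun v : ℂ => calA χ x (ρ + ((k : ℂ) * I * (alpha D : ℂ) + v)))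
      (Metric.ball 0 r) :=
    (hfk.mono (Metric.ball_subset_ball hrα.le)).analyticOnNhd Metric.isOpen_ball
  obtain ⟨v, hv, -⟩ := existsUnique_zero_of_finsum_analyticOrderNatAt_eq_one hf_an hcount
  exact ⟨v, hv⟩

end Pieces

variable [NeZero D] (χ : DirichletCharacter ℂ D)

/-- **The three zeros of `𝒜(ρ+w,ψ)` in `|w| < α(1+c′α𝓛)`, LOCATED — from (4.12) on `Re w > −α` only**
(`Z22:Lem4.7.pf`, §4 p. 23): given Rouché (`hRouche`, binder), Lemma 4.2 and the half-disc (4.12)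
(`h412` = VERBATIM the conclusion of `Section4.eq412_inner_of`), there is `c₀ = 4C⁺ + 1` such that for
every `c′ ≥ c₀`, `D` large, `ψ ∈ Ψ₁` and a zero `ρ = 1/2 + iγ` of `𝒜(s,ψ)` with `|γ − 2πt₀| < 𝓛₁ + 2`,
the zero set of `𝒜(ρ+·,ψ)` in `|w| < α(1+c′α𝓛)` is `{0, iα + v₁, −iα + v₋₁}` with
`|v_{±1}| < c′α²𝓛`; zeros with `Re w ≤ −α` are handled through the reflection `w ↦ −w̄`
(`llZeroReflect_holds`, `F ≠ 0` on `Ω₁`). [cite: Zhang2022LandauSiegel, §4 Lemma 4.7 (proof)] -/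
theorem three_zeros_of_rouche_inner
    -- FACT F-29 (hypothesis form): Rouché's theorem, exact-count form [Conway 1973, V.3.8]
    (hRouche : ∀ (f g : ℂ → ℂ) (c : ℂ) (r : ℝ), 0 < r →
      (∃ U : Set ℂ, IsOpen U ∧ Metric.closedBall c r ⊆ U ∧ DifferentiableOn ℂ f U ∧
        DifferentiableOn ℂ g U) →
      (∀ z ∈ Metric.sphere c r, ‖f z - g z‖ < ‖g z‖) →
      ∑ᶠ z ∈ Metric.ball c r, analyticOrderNatAt f z =
        ∑ᶠ z ∈ Metric.ball c r, analyticOrderNatAt g z)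
    (h42 : Lemma42)
    (h412 : ∃ C : ℝ, ForAllLarge fun D _ χ => ∀ x ∈ PsiOne χ, ∀ ρ ∈ lemma46Region D,
      calA χ x ρ = 0 → ∀ w : ℂ, ‖w‖ < 2 * alpha D → -alpha D < w.re →
        ‖calA χ x (1 / 2 + ρ.im * I + w) - (1 - Pm2w D w)‖ ≤ C * (alpha D * ell D)) :
    ∃ c₀ : ℝ, ∀ c' : ℝ, c₀ ≤ c' →
      ForAllLarge fun D _ χ => ∀ x ∈ PsiOne χ, ∀ ρ : ℂ, calA χ x ρ = 0 → ρ.re = 1 / 2 →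
        |ρ.im - 2 * π * t0 D| < ell1 D + 2 →
          ∃ v₁ vm : ℂ, ‖v₁‖ < c' * alpha D ^ 2 * ell D ∧ ‖vm‖ < c' * alpha D ^ 2 * ell D ∧
            {w : ℂ | ‖w‖ < alpha D * (1 + c' * alpha D * ell D) ∧ calA χ x (ρ + w) = 0} =
              {(0 : ℂ), I * (alpha D : ℂ) + v₁, -(I * (alpha D : ℂ)) + vm} := by
  obtain ⟨C₂, h42⟩ := h42
  obtain ⟨C, h412⟩ := h412
  set Cp : ℝ := max C 0 with hCp
  have hCp0 : 0 ≤ Cp := le_max_right _ _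
  have hCCp : C ≤ Cp := le_max_left _ _
  refine ⟨4 * Cp + 1, fun c' hc' => ?_⟩
  have hc'pos : 0 < c' := by linarith
  obtain ⟨D₁, hD₁, hδD⟩ := exists_delta_le c' (1 / 200) (by norm_num)
  obtain ⟨D₂, hD₂, hηD⟩ := exists_delta_le Cp (1 / 8) (by norm_num)
  have h413 : Eq413 c' := eq413_of_pos hc'pos
  have hone : OneSubPwOneZero c' := oneSubPwOneZero_of_nonneg hc'pos.le
  obtain ⟨D₀, hD₀⟩ := ((h42.and h412).and h413).and hone
  refine ⟨max (max D₀ (max D₁ D₂)) (max 3 ⌈Real.exp (max 3 (2 * C₂))⌉₊),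
    fun D _ χ hD hq hp x hx ρ hAρ hre hγ => ?_⟩
  have hDD₀ : D₀ ≤ D := le_trans (le_trans (le_max_left _ _) (le_max_left _ _)) hD
  have hD' : max D₁ D₂ ≤ D := le_trans (le_trans (le_max_right _ _) (le_max_left _ _)) hD
  have hDD₁ : D₁ ≤ D := le_trans (le_max_left _ _) hD'
  have hDD₂ : D₂ ≤ D := le_trans (le_max_right _ _) hD'
  have hD3 : 3 ≤ D := le_trans (le_trans (le_max_left _ _) (le_max_right _ _)) hD
  have hDe : ⌈Real.exp (max 3 (2 * C₂))⌉₊ ≤ D :=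
    le_trans (le_trans (le_max_right _ _) (le_max_right _ _)) hD
  obtain ⟨hℓ3, hℓC⟩ := max_le_iff.mp (le_ell_of_ceil_exp_le hDe)
  have hℓ0 : 0 < ell D := by linarith
  have hD2 : 2 ≤ D := by omega
  obtain ⟨⟨⟨e42, e412⟩, e413⟩, eone⟩ := hD₀ D χ hDD₀ hq hp
  -- the parameters `α`, `δ = c′α𝓛`, `η = C⁺α𝓛`, radii `r = α(1−δ) < α < R = α(1+δ) < 2α`
  have hα : 0 < alpha D := by
    rw [Section2.alpha_eq_pi_div_ell9]; exact div_pos Real.pi_pos (pow_pos hℓ0 9)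
  have hαℓ : 0 < alpha D * ell D := mul_pos hα hℓ0
  set δ : ℝ := c' * alpha D * ell D with hδ
  set η : ℝ := Cp * alpha D * ell D with hη
  have hδ0 : 0 < δ := by rw [hδ, mul_assoc]; exact mul_pos hc'pos hαℓ
  have hδ1 : δ ≤ 1 / 200 := hδD D hDD₁
  have hη0 : 0 ≤ η := by rw [hη, mul_assoc]; exact mul_nonneg hCp0 hαℓ.le
  have hη1 : η ≤ 1 / 8 := hηD D hDD₂
  have h2ηδ : 2 * η < δ := by
    rw [hη, hδ, mul_assoc, mul_assoc]; nlinarith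
  set r : ℝ := alpha D * (1 - δ) with hr
  set R : ℝ := alpha D * (1 + δ) with hR
  have hr0 : 0 < r := by rw [hr]; exact mul_pos hα (by linarith)
  have hrα : r < alpha D := by rw [hr]; nlinarith
  have hR2α : R < 2 * alpha D := by rw [hR]; nlinarith
  have hRpos : 0 < R := by rw [hR]; positivity
  -- `ρ = 1/2 + iγ` is in Lemma 4.6's region
  have hρeq : (1 / 2 : ℂ) + (ρ.im : ℂ) * I = ρ := by
    apply Complex.ext <;> simp [hre]
  have hρ46 : ρ ∈ lemma46Region D := by
    refine ⟨by rw [hre], ?_, hγ⟩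
    rw [hre]; have := pow_pos hα 2; linarith
  -- `𝒜(ρ + ·)` is holomorphic on `|w| < 2α`
  have hA : DifferentiableOn ℂ (fun w : ℂ => calA χ x (ρ + w)) (Metric.ball 0 (2 * alpha D)) := by
    have h := differentiableOn_calA_shift χ hD3 hp hℓ3 hℓC x (e42 x hx) hγ
    simpa only [hρeq] using h
  -- (4.12) around `ρ` on `Re w > −α`: `|𝒜(ρ+w) − (1 − P^{−2w})| ≤ η` for `|w| < 2α`
  have E412 : ∀ w : ℂ, ‖w‖ < 2 * alpha D → -alpha D < w.re →
      ‖calA χ x (ρ + w) - (1 - Pm2w D w)‖ ≤ η := by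
    intro w hw hwre
    have h := e412 x hx ρ hρ46 hAρ w hw hwre
    rw [hρeq] at h
    refine h.trans ?_
    rw [hη, mul_assoc]
    exact mul_le_mul_of_nonneg_right hCCp hαℓ.le
  -- the reflection `w ↦ −w̄` of the zeros of `𝒜(ρ + ·)` (`ρ` on the line; `F ≠ 0` on `Ω₁`)
  have hsymm : ∀ w : ℂ, ‖w‖ < 2 * alpha D → calA χ x (ρ + w) = 0 →
      calA χ x (ρ + -(starRingEnd ℂ w)) = 0 := by
    intro w hw hzero
    have hℓ1 : 1 ≤ ell D := by linarith
    have hhalf : C₂ * (ell D ^ 227)⁻¹ ≤ 1 / 2 := by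
      have h227 : ell D ≤ ell D ^ 227 := by
        calc ell D = ell D ^ 1 := (pow_one _).symm
          _ ≤ ell D ^ 227 := pow_le_pow_right₀ hℓ1 (by norm_num)
      rw [← div_eq_mul_inv, div_le_iff₀ (pow_pos hℓ0 _)]
      linarith
    have hΩ1 : ρ + w ∈ Omega1 D := by
      have h := half_add_mem_Omega1 hℓ3 hγ hw
      rwa [hρeq] at h
    have hF : Fpoly χ x (ρ + w) ≠ 0 :=
      (inv_norm_le_two_mul_of_norm_mul_sub_one_le ((e42 x hx _ hΩ1).trans hhalf)).1
    have hLL : LL χ x (ρ + w) = 0 := by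
      rw [calA, div_eq_zero_iff] at hzero
      exact hzero.resolve_right hF
    have hpos : 0 < (ρ + w).re := by
      have hwre : |w.re| < 2 * alpha D := lt_of_le_of_lt (Complex.abs_re_le_norm w) hw
      have hαsmall : 2 * alpha D ≤ 1 / 100 := by
        have h2α := two_mul_alpha_le_of_three_le_ell hℓ3
        have hlog : Real.log (ell D) / (100 * ell D) ≤ 1 / 100 := by
          rw [div_le_div_iff₀ (by positivity) (by norm_num), one_mul]
          linarith [Real.log_le_sub_one_of_pos hℓ0]
        linarith
      rw [Complex.add_re, hre]
      have := (abs_lt.mp hwre).1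
      linarith
    have hrefl := llZeroReflect_holds D χ x hD3 hq hp (ρ + w) hpos hLL
    have heq : 1 - starRingEnd ℂ (ρ + w) = ρ + -(starRingEnd ℂ w) := by
      apply Complex.ext <;> simp [hre] <;> ring
    rw [heq] at hrefl
    rw [calA, hrefl, zero_div]
  -- (4.13) on `|z| = r`: `|1 − P^{−2z}| > 6δ > η`
  have hbig : ∀ z : ℂ, ‖z‖ = r → η < ‖1 - Pm2w D z‖ := by
    intro z hz
    have h2 : 6 * c' * alpha D * ell D < ‖1 - Pm2w D z‖ := e413 z hz
    have h3 : 6 * c' * alpha D * ell D = 6 * δ := by rw [hδ]; ring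
    linarith
  have near : ∀ w : ℂ, ‖w‖ < 2 * alpha D → calA χ x (ρ + w) = 0 →
      ∃ k : ℤ, ‖w - (k : ℂ) * I * (alpha D : ℂ)‖ ≤ 2 * η * alpha D :=
    fun w hw hz => zero_near_lattice_of_inner χ x ρ hℓ0 hα hη1 E412 hsymm hw hz
  have key : ∀ k : ℤ, |k| ≤ 1 →
      ∃ v : ℂ, {v' : ℂ | ‖v'‖ < r ∧ calA χ x (ρ + ((k : ℂ) * I * (alpha D : ℂ) + v')) = 0} = {v} :=
    fun k hk => small_disc_unique_zero_inner χ x ρ hRouche hℓ0 hD2 hα hr0 hrα hA E412 hbig eone hk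
  obtain ⟨v₁, hv₁⟩ := key 1 (by norm_num)
  obtain ⟨v₀, hv₀⟩ := key 0 (by norm_num)
  obtain ⟨vm, hvm⟩ := key (-1) (by norm_num)
  have hsum : 2 * η * alpha D + r ≤ alpha D := by rw [hr]; nlinarith
  obtain ⟨hv₁n, hv₁z⟩ := small_disc_zero_norm_le χ x ρ hα hrα hsum near (by norm_num) hv₁
  obtain ⟨hvmn, hvmz⟩ := small_disc_zero_norm_le χ x ρ hα hrα hsum near (by norm_num) hvm
  have h2ηr : 2 * η * alpha D < r := by
    rw [hr]; nlinarith [mul_pos hα (show (0:ℝ) < 1 - δ - 2 * η by linarith)]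
  have hR2 : R + 2 * η * alpha D ≤ 2 * alpha D := by rw [hR]; nlinarith
  have hRin : alpha D + 2 * η * alpha D < R := by rw [hR]; nlinarith
  have hbound : 2 * η * alpha D < c' * alpha D ^ 2 * ell D := by
    have : c' * alpha D ^ 2 * ell D = δ * alpha D := by rw [hδ]; ring
    rw [this]; nlinarith
  exact ⟨v₁, vm, lt_of_le_of_lt hv₁n hbound, lt_of_le_of_lt hvmn hbound,
    zeros_eq_three χ x ρ hα hr0 hRpos hR2α h2ηr hR2 hRin hAρ near hv₁ hv₀ hvm hv₁n hv₁z hvmn hvmz⟩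

end Literature.NumberTheory.LFunctions.Zhang2022.Section4
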